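import Mathlib
import Summits.ResolutionOfSingularities.ResolutionOfSingularities.Theorems.WildQuotientsWildQuotientResolutionLinearCubeZeroOfJordanThree
import Summits.ResolutionOfSingularities.ResolutionOfSingularities.Theorems.WildQuotientsWildQuotientResolutionToricExitJordanThreeFinal

/-!
# G1: every linear `σ` with `(σ − 1)³ = 0` on `𝔸ⁿ`, `n ≤ 4`, `p ≥ 3` — the quotient `𝔸ⁿ/σ` has a resolution

(crux stmt-ResolutionOfSingularities-15640 `WildQuotients.WildQuotientResolution`, line `Sketch`,
sector `|G| = p`; programme V3U of `L/w45c/CHAIN.md` v7 §4 row stub-4 «G1 one-liner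
`linearCyclicQuotient_hasResolution_of_cube_zero` all `p ≥ 3` the minute F1 lands»; signature =
`L/w45c/W45cPlanSignaturesV5.lean` G1 VERBATIM. [OURS · L1 W4.5c] — NOT a statement of any
manuscript; replaces the role of no printed item. Prover res-L1-w45c-stub-4.)

Composition of the kernel-checked reduction `linearCyclicQuotient_hasResolution_of_cube_zero_of_jordanThree`
(p484872: JNF-3 p479366 splits a linear `σ` with `(σ−1)³ = 0`, `n ≤ 4`, into a blocks-`≤ 2` datum —
`LinearSmallBlocks.hasResolution` — or a `J₃` datum after conjugation, `TameTransfer` p471072) with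
the `J₃` final F1 `ToricExit.jordanThree_hasResolution` (lead-1; every `p ≥ 3`, every field of
characteristic `p`, every `n`). For `p = 3` this is the PRIZE p486874 again; for `p ≥ 5` it is the
linear sector of stmt-17941 short of `J₄` (stmt-17942, V4U).
-/

-- single-problem summit: the doubled namespace component `ResolutionOfSingularities` is forced
set_option linter.dupNamespace false

noncomputable section

open AlgebraicGeometry MvPolynomial
open Literature.AlgebraicGeometry.Resolution

namespace Summit.ResolutionOfSingularities.ResolutionOfSingularities.Theorems.WildQuotientResolution.LinearCubeZero

/-- **G1.** For every prime `p ≥ 3`, every field `k` of characteristic `p`, every `n ≤ 4` and every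
LINEAR `k`-algebra automorphism `σ` of `k[x₁,…,xₙ]` with `(σ − 1)³ = 0` on the variables, the
quotient `Spec k[x]^{⟨σ⟩}` has a resolution of singularities (Jordan types `3+1`, `3` by the `J₃`
toric exit F1; `2+2`, `2+1+1`, `2+1`, `2`, trivial by the blocks-`≤ 2` theorem). [OURS · L1 W4.5c] -/
theorem linearCyclicQuotient_hasResolution_of_cube_zero (p : ℕ) (hp : p.Prime) (hp3 : 3 ≤ p)
    (k : Type) [Field k] [CharP k p] (n : ℕ) (hn : n ≤ 4)
    (σ : MvPolynomial (Fin n) k ≃ₐ[k] MvPolynomial (Fin n) k)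
    (hlin : ∀ i, σ (X i) ∈ Submodule.span k (Set.range (X : Fin n → MvPolynomial (Fin n) k)))
    (hcube : ∀ i, σ (σ (σ (X i) - X i) - (σ (X i) - X i)) = σ (σ (X i) - X i) - (σ (X i) - X i)) :
    Scheme.HasResolution
      (Spec (.of (FixedPoints.subalgebra k (MvPolynomial (Fin n) k) (Subgroup.zpowers σ)))) :=
  linearCyclicQuotient_hasResolution_of_cube_zero_of_jordanThree p hp k
    (fun n σ a b c hab hbc hac hb hc hσ =>
      ToricExit.jordanThree_hasResolution p hp hp3 k n σ a b c hab hbc hac hb hc hσ)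
    n hn σ hlin hcube

end Summit.ResolutionOfSingularities.ResolutionOfSingularities.Theorems.WildQuotientResolution.LinearCubeZero

end
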